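import Mathlib.Analysis.SpecialFunctions.Trigonometric.InverseDeriv
import Mathlib.Analysis.SpecialFunctions.Pow.Deriv
import Mathlib.Analysis.SpecialFunctions.Trigonometric.Bounds
import Mathlib.Analysis.Calculus.ContDiff.Bounds
import Mathlib.Analysis.Calculus.IteratedDeriv.Lemmas
import HarnessLib

/-!
# Derivatives of `arccos` of all orders and the transfer of angle-derivative bounds to `x = cos θ`

Topic `Literature/Analysis/Fourier`.  A cosine polynomial `F(θ) = Σ_m w_m cos(mθ)` is a polynomial
`G(x) = Σ_m w_m T_m(x)` in `x = cos θ`; bounds on the `θ`-derivatives of `F` away from `θ = 0` become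
bounds on the `x`-derivatives of `G = F ∘ arccos` through the Faà di Bruno estimate
`‖(g ∘ f)^{(n)}‖ ≤ n! C D^n` (Mathlib's `norm_iteratedFDerivWithin_comp_le`) once the derivatives of
`arccos` are controlled: `|arccos^{(i)}(x)| ≤ C_i θ^{1-2i}`, `θ = arccos x ∈ (0, π/2]`
(`exists_abs_iteratedDeriv_arccos_le`, from `arccos' = -(1-x)^{-1/2}(1+x)^{-1/2}` and Leibniz).
Applied to the RESCALED pair `u ↦ F(u/t)`, `x ↦ t·arccos x` this gives, for `tθ ≥ 1`,

  `|G^{(n)}(x)| ≤ K_n · A · (t/θ)^n` whenever `|F^{(i)}(θ)| ≤ A t^i` (`i ≤ n`)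

(`exists_abs_iteratedDeriv_comp_arccos_le`), i.e. with `A ≍ (tθ)^{-j}`: `|G^{(n)}(x)| ≲ t^{2n}(tθ)^{-n-j}` —
the scale-invariant symbol estimates `λ^ℓ|∂_λ^ℓ W_t(λ)| ≤ C_{ℓ,n}(1+t²λ)^{-n}` of Bauerschmidt's
finite-range polynomials in the tail `t²λ ≳ 1` [Bauerschmidt2013, Lemma 2.3], [Buchholz2016, Lemma 5.1 (5.3)],
obtained here without Poisson summation.  Everything is proved; no named facts.

## References
* R. Bauerschmidt, Probab. Theory Relat. Fields 157 (2013), Lemma 2.3 [Bauerschmidt2013].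
* S. Buchholz, J. Funct. Anal. 275 (2018), Lemma 5.1 [Buchholz2016].
-/

noncomputable section

open Set Finset
open scoped Real Nat

namespace Literature.Analysis.Fourier

/-! ## Iterated derivatives of `(1 - y)^r` and `(1 + y)^r` -/

/-- The falling coefficient `Π_{j<k} (j - r)` of `((1-y)^r)^{(k)} = Π_{j<k}(j-r) · (1-y)^{r-k}`. [folklore] -/
def fallCoeff (r : ℝ) (k : ℕ) : ℝ := ∏ j ∈ Finset.range k, ((j : ℝ) - r)

/-- `(d/dy)^k (1-y)^r = Π_{j<k}(j-r) (1-y)^{r-k}` for `y < 1`. [folklore] -/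
private theorem iteratedDeriv_one_sub_rpow (r : ℝ) :
    ∀ (k : ℕ) {y : ℝ}, y < 1 → iteratedDeriv k (fun y : ℝ => (1 - y) ^ r) y = fallCoeff r k * (1 - y) ^ (r - k)
  | 0, y, _ => by simp [fallCoeff]
  | k + 1, y, hy => by
    rw [iteratedDeriv_succ]
    have hev : iteratedDeriv k (fun y : ℝ => (1 - y) ^ r) =ᶠ[nhds y]
        fun y => fallCoeff r k * (1 - y) ^ (r - k) := by
      filter_upwards [isOpen_Iio.mem_nhds hy] with z hz using iteratedDeriv_one_sub_rpow r k hz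
    rw [hev.deriv_eq]
    have hd : HasDerivAt (fun y : ℝ => fallCoeff r k * (1 - y) ^ (r - k))
        (fallCoeff r k * ((-1) * (r - k) * (1 - y) ^ (r - k - 1))) y :=
      (((hasDerivAt_id y).const_sub 1).rpow_const (Or.inl (by simp; linarith))).const_mul _
    rw [hd.deriv, show fallCoeff r (k + 1) = fallCoeff r k * ((k : ℝ) - r) from Finset.prod_range_succ _ _]
    push_cast
    ring_nf

/-- `(d/dy)^k (1+y)^r = Π_{j<k}(r-j) (1+y)^{r-k}` for `y > -1`, written with `fallCoeff`:
`Π_{j<k}(r - j) = (-1)^k Π_{j<k}(j - r)`. [folklore] -/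
private theorem iteratedDeriv_one_add_rpow (r : ℝ) :
    ∀ (k : ℕ) {y : ℝ}, -1 < y →
      iteratedDeriv k (fun y : ℝ => (1 + y) ^ r) y = (-1) ^ k * fallCoeff r k * (1 + y) ^ (r - k)
  | 0, y, _ => by simp [fallCoeff]
  | k + 1, y, hy => by
    rw [iteratedDeriv_succ]
    have hev : iteratedDeriv k (fun y : ℝ => (1 + y) ^ r) =ᶠ[nhds y]
        fun y => (-1) ^ k * fallCoeff r k * (1 + y) ^ (r - k) := by
      filter_upwards [isOpen_Ioi.mem_nhds hy] with z hz using iteratedDeriv_one_add_rpow r k hz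
    rw [hev.deriv_eq]
    have hd : HasDerivAt (fun y : ℝ => (-1) ^ k * fallCoeff r k * (1 + y) ^ (r - k))
        ((-1) ^ k * fallCoeff r k * (1 * (r - k) * (1 + y) ^ (r - k - 1))) y :=
      (((hasDerivAt_id y).const_add 1).rpow_const (Or.inl (by simp; linarith))).const_mul _
    rw [hd.deriv, show fallCoeff r (k + 1) = fallCoeff r k * ((k : ℝ) - r) from Finset.prod_range_succ _ _]
    push_cast
    ring_nf

/-! ## The derivative of `arccos` as a product and its iterated derivatives -/

/-- `h(y) = (1-y)^{-1/2} (1+y)^{-1/2}`; on `(-1,1)` this is `1/√(1-y²) = -arccos'(y)`. [folklore] -/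
def invSqrtOneSubSq (y : ℝ) : ℝ := (1 - y) ^ (-(1 / 2 : ℝ)) * (1 + y) ^ (-(1 / 2 : ℝ))

/-- `deriv arccos y = -h(y)` on `(-1,1)`. [folklore] -/
private theorem deriv_arccos_eq_neg_invSqrtOneSubSq {y : ℝ} (hy : y ∈ Ioo (-1 : ℝ) 1) :
    deriv Real.arccos y = -invSqrtOneSubSq y := by
  rw [Real.deriv_arccos, invSqrtOneSubSq]
  simp only
  rw [Set.mem_Ioo] at hy
  have h1 : 0 < 1 - y := by linarith
  have h2 : 0 < 1 + y := by linarith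
  rw [show 1 - y ^ 2 = (1 - y) * (1 + y) by ring, Real.sqrt_eq_rpow, ← Real.mul_rpow h1.le h2.le,
    Real.rpow_neg (by positivity), one_div]

/-- `h` is smooth on `(-1,1)`. [folklore] -/
private theorem contDiffOn_invSqrtOneSubSq {n : WithTop ℕ∞} : ContDiffOn ℝ n invSqrtOneSubSq (Ioo (-1 : ℝ) 1) := by
  intro y hy
  unfold invSqrtOneSubSq
  rw [Set.mem_Ioo] at hy
  refine ContDiffAt.contDiffWithinAt ?_
  exact ((contDiffAt_const.sub contDiffAt_id).rpow_const_of_ne (by simp; linarith)).mul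
    ((contDiffAt_const.add contDiffAt_id).rpow_const_of_ne (by simp; linarith))

/-- **Bound for the iterated derivatives of `h`** on `[0,1)`:
`|h^{(m)}(y)| ≤ K_m (1-y)^{-1/2-m}` (Leibniz). [folklore] -/
private theorem exists_abs_iteratedDeriv_invSqrtOneSubSq_le (m : ℕ) : ∃ K, 0 ≤ K ∧ ∀ y : ℝ, 0 ≤ y → y < 1 →
    |iteratedDeriv m invSqrtOneSubSq y| ≤ K * (1 - y) ^ (-(1 / 2 : ℝ) - m) := by
  refine ⟨∑ i ∈ Finset.range (m + 1), (m.choose i : ℝ) * |fallCoeff (-(1 / 2)) i| * |fallCoeff (-(1 / 2)) (m - i)|,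
    sum_nonneg fun i _ => by positivity, fun y hy0 hy1 => ?_⟩
  have hs : IsOpen (Ioo (-1 : ℝ) 1) := isOpen_Ioo
  have hy : y ∈ Ioo (-1 : ℝ) 1 := ⟨by linarith, hy1⟩
  have h1 : 0 < 1 - y := by linarith
  have hf : ContDiffOn ℝ m (fun y : ℝ => (1 - y) ^ (-(1 / 2 : ℝ))) (Ioo (-1 : ℝ) 1) := fun z hz =>
    ((contDiffAt_const.sub contDiffAt_id).rpow_const_of_ne (by simp; linarith [hz.2])).contDiffWithinAt
  have hg : ContDiffOn ℝ m (fun y : ℝ => (1 + y) ^ (-(1 / 2 : ℝ))) (Ioo (-1 : ℝ) 1) := fun z hz =>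
    ((contDiffAt_const.add contDiffAt_id).rpow_const_of_ne (by simp; linarith [hz.1])).contDiffWithinAt
  have hL := norm_iteratedFDerivWithin_mul_le hf hg hs.uniqueDiffOn hy (n := m) le_rfl
  rw [← iteratedDerivWithin_eq_iteratedDeriv hs.uniqueDiffOn (contDiffOn_invSqrtOneSubSq.contDiffWithinAt hy |>.contDiffAt (hs.mem_nhds hy)) hy,
    ← Real.norm_eq_abs, ← norm_iteratedFDerivWithin_eq_norm_iteratedDerivWithin]
  refine (le_of_eq (by rfl)).trans (hL.trans ?_)
  rw [sum_mul]
  refine sum_le_sum fun i hi => ?_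
  rw [Finset.mem_range] at hi
  rw [iteratedFDerivWithin_of_isOpen _ hs hy, iteratedFDerivWithin_of_isOpen _ hs hy,
    norm_iteratedFDeriv_eq_norm_iteratedDeriv, norm_iteratedFDeriv_eq_norm_iteratedDeriv,
    iteratedDeriv_one_sub_rpow _ i hy1, iteratedDeriv_one_add_rpow _ (m - i) hy.1, Real.norm_eq_abs,
    Real.norm_eq_abs, abs_mul, abs_mul, abs_mul, abs_pow, abs_neg, abs_one, one_pow, one_mul,
    abs_of_pos (Real.rpow_pos_of_pos h1 _), abs_of_pos (Real.rpow_pos_of_pos (by linarith) _)]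
  -- `(1-y)^{-1/2-i} ≤ (1-y)^{-1/2-m}` and `(1+y)^{-1/2-(m-i)} ≤ 1`
  have e1 : (1 - y) ^ (-(1 / 2 : ℝ) - i) ≤ (1 - y) ^ (-(1 / 2 : ℝ) - m) :=
    Real.rpow_le_rpow_of_exponent_ge h1 (by linarith) (by
      have : (i : ℝ) ≤ m := by exact_mod_cast (by omega : i ≤ m)
      linarith)
  have e2 : (1 + y) ^ (-(1 / 2 : ℝ) - ((m - i : ℕ) : ℝ)) ≤ 1 :=
    Real.rpow_le_one_of_one_le_of_nonpos (by linarith) (by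
      have : (0 : ℝ) ≤ ((m - i : ℕ) : ℝ) := Nat.cast_nonneg _
      linarith)
  have hA : 0 ≤ (m.choose i : ℝ) * |fallCoeff (-(1 / 2)) i| := by positivity
  have hB : 0 ≤ |fallCoeff (-(1 / 2)) (m - i)| := abs_nonneg _
  calc (m.choose i : ℝ) * (|fallCoeff (-(1 / 2)) i| * (1 - y) ^ (-(1 / 2 : ℝ) - i)) *
        (|fallCoeff (-(1 / 2)) (m - i)| * (1 + y) ^ (-(1 / 2 : ℝ) - ((m - i : ℕ) : ℝ)))
      = ((m.choose i : ℝ) * |fallCoeff (-(1 / 2)) i| * |fallCoeff (-(1 / 2)) (m - i)|) *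
          ((1 - y) ^ (-(1 / 2 : ℝ) - i) * (1 + y) ^ (-(1 / 2 : ℝ) - ((m - i : ℕ) : ℝ))) := by ring
    _ ≤ ((m.choose i : ℝ) * |fallCoeff (-(1 / 2)) i| * |fallCoeff (-(1 / 2)) (m - i)|) *
          ((1 - y) ^ (-(1 / 2 : ℝ) - m) * 1) := by
        refine mul_le_mul_of_nonneg_left ?_ (mul_nonneg hA hB)
        exact mul_le_mul e1 e2 (Real.rpow_nonneg (by linarith) _) (Real.rpow_nonneg h1.le _)
    _ = (m.choose i : ℝ) * |fallCoeff (-(1 / 2)) i| * |fallCoeff (-(1 / 2)) (m - i)| *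
          (1 - y) ^ (-(1 / 2 : ℝ) - m) := by ring

/-- `1 - cos θ ≥ (2/π²) θ²` for `|θ| ≤ π`. [folklore] -/
private theorem two_div_pi_sq_mul_sq_le_one_sub_cos {θ : ℝ} (hθ : |θ| ≤ π) : 2 / π ^ 2 * θ ^ 2 ≤ 1 - Real.cos θ := by
  have := Real.cos_le_one_sub_mul_cos_sq hθ
  linarith

/-- **Derivatives of `arccos` of all orders**: for `i ≥ 1` there is `C` with
`|arccos^{(i)}(y)| ≤ C / (arccos y)^{2i-1}` for `0 ≤ y < 1` (i.e. `≤ C θ^{1-2i}`, `θ = arccos y ∈ (0,π/2]`).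
[folklore] -/
private theorem exists_abs_iteratedDeriv_arccos_le (i : ℕ) (hi : 1 ≤ i) : ∃ C, 0 ≤ C ∧ ∀ y : ℝ, 0 ≤ y → y < 1 →
    |iteratedDeriv i Real.arccos y| ≤ C / Real.arccos y ^ (2 * i - 1) := by
  obtain ⟨m, rfl⟩ : ∃ m, i = m + 1 := ⟨i - 1, by omega⟩
  obtain ⟨K, hK0, hK⟩ := exists_abs_iteratedDeriv_invSqrtOneSubSq_le m
  refine ⟨K * (π ^ 2 / 2) ^ ((1 / 2 : ℝ) + m), by positivity, fun y hy0 hy1 => ?_⟩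
  have hs : IsOpen (Ioo (-1 : ℝ) 1) := isOpen_Ioo
  have hy : y ∈ Ioo (-1 : ℝ) 1 := ⟨by linarith, hy1⟩
  -- `arccos^{(m+1)} = (-h)^{(m)}` near `y`
  have hev : deriv Real.arccos =ᶠ[nhds y] (-invSqrtOneSubSq) := by
    filter_upwards [hs.mem_nhds hy] with z hz using by
      rw [Pi.neg_apply]; exact deriv_arccos_eq_neg_invSqrtOneSubSq hz
  rw [iteratedDeriv_succ', hev.iteratedDeriv_eq, iteratedDeriv_neg, abs_neg]
  refine (hK y hy0 hy1).trans ?_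
  -- `1 - y = 1 - cos θ ≥ (2/π²) θ²`, `θ = arccos y ∈ (0, π/2]`
  set θ := Real.arccos y with hθ
  have hθpos : 0 < θ := Real.arccos_pos.2 hy1
  have hθle : θ ≤ π := Real.arccos_le_pi y
  have hcos : 1 - y = 1 - Real.cos θ := by rw [hθ, Real.cos_arccos (by linarith) hy1.le]
  have hlow : 2 / π ^ 2 * θ ^ 2 ≤ 1 - y := by
    rw [hcos]; exact two_div_pi_sq_mul_sq_le_one_sub_cos (by rw [abs_of_pos hθpos]; exact hθle)
  have hlowpos : 0 < 2 / π ^ 2 * θ ^ 2 := by positivity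
  have hexp : -(1 / 2 : ℝ) - m ≤ 0 := by
    have : (0 : ℝ) ≤ m := Nat.cast_nonneg m
    linarith
  have step : (1 - y) ^ (-(1 / 2 : ℝ) - m) ≤ (2 / π ^ 2 * θ ^ 2) ^ (-(1 / 2 : ℝ) - m) :=
    Real.rpow_le_rpow_of_nonpos hlowpos hlow hexp
  have hrew : (2 / π ^ 2 * θ ^ 2) ^ (-(1 / 2 : ℝ) - m) = (π ^ 2 / 2) ^ ((1 / 2 : ℝ) + m) / θ ^ (2 * (m + 1) - 1) := by
    rw [Real.mul_rpow (by positivity) (by positivity)]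
    have e1 : (2 / π ^ 2 : ℝ) ^ (-(1 / 2 : ℝ) - m) = (π ^ 2 / 2) ^ ((1 / 2 : ℝ) + m) := by
      rw [show (2 / π ^ 2 : ℝ) = (π ^ 2 / 2)⁻¹ by rw [inv_div], Real.inv_rpow (by positivity),
        ← Real.rpow_neg (by positivity)]
      congr 1; ring
    have e2 : (θ ^ 2 : ℝ) ^ (-(1 / 2 : ℝ) - m) = 1 / θ ^ (2 * (m + 1) - 1) := by
      have hcast : (((2 * (m + 1) - 1 : ℕ)) : ℝ) = 2 * m + 1 := by
        rw [Nat.cast_sub (by omega)]; push_cast; ring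
      rw [show (θ ^ 2 : ℝ) = θ ^ ((2 : ℕ) : ℝ) by rw [Real.rpow_natCast], ← Real.rpow_mul hθpos.le,
        show ((2 : ℕ) : ℝ) * (-(1 / 2 : ℝ) - m) = -(((2 * (m + 1) - 1 : ℕ) : ℝ)) by rw [hcast]; push_cast; ring,
        Real.rpow_neg hθpos.le, Real.rpow_natCast, one_div]
    rw [e1, e2]
    ring
  calc K * (1 - y) ^ (-(1 / 2 : ℝ) - m) ≤ K * (2 / π ^ 2 * θ ^ 2) ^ (-(1 / 2 : ℝ) - m) :=
        mul_le_mul_of_nonneg_left step hK0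
    _ = K * (π ^ 2 / 2) ^ ((1 / 2 : ℝ) + m) / θ ^ (2 * (m + 1) - 1) := by rw [hrew]; ring

/-! ## Transfer of derivative bounds from `θ` to `x = cos θ` -/

/-- **Composition estimate** (rescaled Faà di Bruno).  For every `n` there is `K_n > 0` such that: if
`F` is smooth, `t ≥ 1`, `0 ≤ y < 1`, `θ = arccos y` with `tθ ≥ 1`, and `|F^{(i)}(θ)| ≤ A t^i` for `i ≤ n`,
then `|(F ∘ arccos)^{(n)}(y)| ≤ K_n A (t/θ)^n`.  With `A ≍ (tθ)^{-j}` this is the tail symbol estimate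
`λ^ℓ|∂_λ^ℓ W_t| ≲ (t²λ)^{-j/2}` in the variable `x = cos θ = 1 - λ/(2B)`. [cite: Buchholz2016, Lemma 5.1 (5.3)] -/
theorem exists_abs_iteratedDeriv_comp_arccos_le (n : ℕ) : ∃ K, 0 < K ∧ ∀ (F : ℝ → ℝ),
    (∀ k : ℕ, ContDiff ℝ k F) → ∀ (t : ℝ), 1 ≤ t → ∀ (y : ℝ), 0 ≤ y → y < 1 → 1 ≤ t * Real.arccos y →
      ∀ (A : ℝ), 0 ≤ A → (∀ i, i ≤ n → |iteratedDeriv i F (Real.arccos y)| ≤ A * t ^ i) →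
        |iteratedDeriv n (fun x => F (Real.arccos x)) y| ≤ K * A * (t / Real.arccos y) ^ n := by
  -- constants for the derivatives of `arccos`
  have hC : ∀ i : ℕ, ∃ C, 0 ≤ C ∧ (1 ≤ i → ∀ y : ℝ, 0 ≤ y → y < 1 →
      |iteratedDeriv i Real.arccos y| ≤ C / Real.arccos y ^ (2 * i - 1)) := by
    intro i
    rcases Nat.eq_zero_or_pos i with h0 | hpos
    · exact ⟨0, le_rfl, fun h => absurd (h0 ▸ h) (by norm_num)⟩
    · obtain ⟨C, hC0, hC⟩ := exists_abs_iteratedDeriv_arccos_le i hpos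
      exact ⟨C, hC0, fun _ => hC⟩
  choose C hC0 hC using hC
  set K₀ : ℝ := 1 + ∑ i ∈ Finset.range (n + 1), C i with hK₀
  have hK₀1 : 1 ≤ K₀ := by
    have : 0 ≤ ∑ i ∈ Finset.range (n + 1), C i := sum_nonneg fun i _ => hC0 i
    linarith
  have hCK : ∀ i, i ≤ n → C i ≤ K₀ := by
    intro i hi
    have : C i ≤ ∑ i ∈ Finset.range (n + 1), C i :=
      single_le_sum (f := C) (fun i _ => hC0 i) (Finset.mem_range.2 (by omega))
    linarith
  refine ⟨(n ! : ℝ) * K₀ ^ n, by positivity, fun F hF t ht y hy0 hy1 hfar A hA hFA => ?_⟩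
  set θ := Real.arccos y with hθdef
  have hθpos : 0 < θ := Real.arccos_pos.2 hy1
  have htpos : 0 < t := by linarith
  have hs : IsOpen (Ioo (-1 : ℝ) 1) := isOpen_Ioo
  have hy : y ∈ Ioo (-1 : ℝ) 1 := ⟨by linarith, hy1⟩
  -- the rescaled pair
  set g : ℝ → ℝ := fun u => F (t⁻¹ * u) with hg
  set f : ℝ → ℝ := fun x => t * Real.arccos x with hf
  have hcomp : (fun x => F (Real.arccos x)) = g ∘ f := by
    funext x; simp only [hg, hf, Function.comp_apply]; congr 1; field_simp
  have hgcd : ContDiff ℝ n g := (hF n).comp (contDiff_const.mul contDiff_id)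
  have hfcd : ContDiffOn ℝ n f (Ioo (-1 : ℝ) 1) := fun z hz =>
    (contDiffAt_const.mul (Real.contDiffAt_arccos (by linarith [hz.1]) (by linarith [hz.2]))).contDiffWithinAt
  -- bounds on the derivatives of `g` at `f y = tθ`
  have hgC : ∀ i, i ≤ n → ‖iteratedFDerivWithin ℝ i g univ (f y)‖ ≤ A := by
    intro i hi
    rw [iteratedFDerivWithin_univ, norm_iteratedFDeriv_eq_norm_iteratedDeriv, hg,
      iteratedDeriv_comp_const_smul (hF i) t⁻¹, Real.norm_eq_abs]
    simp only [hf, smul_eq_mul]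
    rw [show t⁻¹ * (t * Real.arccos y) = θ by rw [hθdef]; field_simp, abs_mul, abs_pow, abs_inv,
      abs_of_pos htpos]
    calc t⁻¹ ^ i * |iteratedDeriv i F θ| ≤ t⁻¹ ^ i * (A * t ^ i) :=
          mul_le_mul_of_nonneg_left (hFA i hi) (by positivity)
      _ = A * (t⁻¹ * t) ^ i := by rw [mul_pow]; ring
      _ = A := by rw [inv_mul_cancel₀ htpos.ne', one_pow, mul_one]
  -- bounds on the derivatives of `f` at `y`
  have hfD : ∀ i, 1 ≤ i → i ≤ n → ‖iteratedFDerivWithin ℝ i f (Ioo (-1 : ℝ) 1) y‖ ≤ (K₀ * t / θ) ^ i := by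
    intro i hi1 hin
    rw [iteratedFDerivWithin_of_isOpen _ hs hy, norm_iteratedFDeriv_eq_norm_iteratedDeriv, hf,
      iteratedDeriv_const_mul _ (Real.contDiffAt_arccos (by linarith) (by linarith)), Real.norm_eq_abs,
      abs_mul, abs_of_pos htpos]
    have h1 := hC i hi1 y hy0 hy1
    rw [← hθdef] at h1
    -- `t C_i θ^{1-2i} ≤ (K₀ t/θ)^i` since `K₀ ≥ max(1, C_i)` and `tθ ≥ 1`
    have hpow : θ ^ (2 * i - 1) = θ ^ i * θ ^ (i - 1) := by rw [← pow_add]; congr 1; omega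
    calc t * |iteratedDeriv i Real.arccos y| ≤ t * (C i / θ ^ (2 * i - 1)) :=
          mul_le_mul_of_nonneg_left h1 htpos.le
      _ = C i * t / (θ ^ i * θ ^ (i - 1)) := by rw [hpow]; ring
      _ ≤ (K₀ ^ i * t ^ i) / (θ ^ i * θ ^ (i - 1)) * θ ^ (i - 1) / 1 := by
          rw [div_one, div_mul_eq_mul_div]
          refine div_le_div_of_nonneg_right ?_ (by positivity)
          -- `C_i t ≤ K₀^i t^i θ^{i-1}` : `C_i ≤ K₀ ≤ K₀^i`, `t ≤ t^i θ^{i-1} = t (tθ)^{i-1}`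
          have e1 : C i ≤ K₀ ^ i := (hCK i hin).trans (le_self_pow₀ hK₀1 (by omega))
          have e2 : t ≤ t ^ i * θ ^ (i - 1) := by
            have : t ^ i * θ ^ (i - 1) = t * (t * θ) ^ (i - 1) := by
              rw [mul_pow, ← mul_assoc, ← pow_succ']; congr 2; omega
            rw [this]
            exact le_mul_of_one_le_right htpos.le (one_le_pow₀ hfar)
          calc C i * t ≤ K₀ ^ i * t := mul_le_mul_of_nonneg_right e1 htpos.le
            _ ≤ K₀ ^ i * (t ^ i * θ ^ (i - 1)) := mul_le_mul_of_nonneg_left e2 (by positivity)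
            _ = K₀ ^ i * t ^ i * θ ^ (i - 1) := by ring
      _ = (K₀ * t / θ) ^ i := by
          rw [div_one, div_pow, mul_pow]
          field_simp
  have hmain := norm_iteratedFDerivWithin_comp_le (g := g) (f := f) (n := n) (s := Ioo (-1 : ℝ) 1) (t := univ)
    (x := y) (N := n) hgcd.contDiffOn hfcd le_rfl uniqueDiffOn_univ hs.uniqueDiffOn (mapsTo_univ _ _) hy hgC hfD
  rw [hcomp, ← Real.norm_eq_abs, ← norm_iteratedFDeriv_eq_norm_iteratedDeriv, ← iteratedFDerivWithin_of_isOpen n hs hy]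
  refine hmain.trans (le_of_eq ?_)
  rw [div_pow, mul_pow, div_pow]
  ring

/-- Derivatives of a function agreeing with `F ∘ arccos` on `(-1,1)` (e.g. the polynomial `Σ w_m T_m` of a
cosine polynomial `F = Σ w_m cos(m·)`). [folklore] -/
private theorem iteratedDeriv_eq_of_eqOn_Ioo {G H : ℝ → ℝ} (hGH : ∀ x ∈ Ioo (-1 : ℝ) 1, G x = H x) (n : ℕ) {y : ℝ}
    (hy : y ∈ Ioo (-1 : ℝ) 1) : iteratedDeriv n G y = iteratedDeriv n H y := by
  have hev : G =ᶠ[nhds y] H := by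
    filter_upwards [isOpen_Ioo.mem_nhds hy] with z hz using hGH z hz
  exact hev.iteratedDeriv_eq n

end Literature.Analysis.Fourier

end
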